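import Summits.QuantumFields.YangMills.Theorems.BalabanUVNodesN21PartialDilationHazard
import Summits.QuantumFields.BalabanUV.T4Continuum.Support.ShellMeasureExpJacobianSUN
import Mathlib.Analysis.Convex.SpecificFunctions.Deriv
import Mathlib.Analysis.SpecialFunctions.Trigonometric.Sinc

/-!
# N21 (NE7c) · the HAAR JACOBIAN is radially non-collapsing (lens Card 73 ∕ ROW F′) — part 18's hypothesis for the
# group-fibre factor

R134 seat pub-ymgap-dag-n21-d (g8), node N21 = NE7c (single-run shell-weight bound, NOT PRINTED in [Bałaban 1983–89],
NOT proved), lane K3⁷ `SpineGivenEndpointR13SepCoPH` (stmt-QuantumFields-20544, `--kind proof --supports … --as helper`).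
Part 24 of the comparison series.  THIS FILE = LENS ROW F′ of `LENS-nearmiss.md` v26.0 (= v25.0 ROW F; first refusal
dag-n21-d): §D of the lens's `Sketch-nearmiss-g25.lean` VERBATIM — statements and proofs — re-homed in this namespace,
importing part 18 `…N21PartialDilationHazard` as the row asks, WITH ONE SUBSTITUTION forced by the dedup rule: the
sketch's `sinc_abs` is DELETED and pub-balaban's identical `ShellMeasureExpJacobianSUN.sinc_abs` is CITED BY NAME (that
module's `expJacSU_le_smul` — `expJacSU v ≤ expJacSU (c • v)` for `‖v‖ ≤ π`, `0 < c ≤ 1` — is the SU(N) exponential-chart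
form of Card 73 already in the tree; §D below is the abstract sinc-product form).  AUTHORSHIP OF THE MATHEMATICS: planner seat
`ym-lens-BalabanUVNodes-nearmiss` g25 (memo-only seat, cannot file); this seat only files.

WHAT (lens Card 73, CLASS B group fibre).  The Haar Jacobian `∏ sinc²(α(X)∕2)` of a compact group chart is RADIALLY
NON-COLLAPSING (`sinc` antitone on `[0, π]`, chord of the concave `sin`), i.e. it satisfies part 18's partial-dilation
hypothesis `g x ≤ g (D_λ x)` by itself; tree dictionary `B10Eq18SigmaSU2Haar` ∕ `HaarDensityCompactExplicit`.

HONEST FRAMING.  [textbook] real analysis; 0 def, 0 sorry; nothing of Bałaban's asserted; NE7c NOT PRINTED ∕ NOT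
proved; N21 NOT discharged; counts unmoved (typed 28∕28 · discharged 5∕27); count-neutral; one finite 𝕋⁴ at fixed ε
— nothing about ℝ⁴ ∕ OS ∕ mass gap ∕ Clay.
-/

open MeasureTheory Set

namespace Summit.QuantumFields.YangMills.Theorems.N21HaarRadialJacobian

open Literature.MathematicalPhysics.QuantumFieldTheory.Balaban1983to89.T4ShellMeasure
  (SlotAntiConcentration slot_field_of_antiConcentration)
open Summit.QuantumFields.BalabanUV.T4Continuum.ShellMeasureExpJacobianSUN (sinc_abs)

/-! ## §D  The Haar Jacobian is radially non-collapsing (Card 73) -/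

/-- Chord of the concave `sin` on `[0, π]` (pattern of `NonuniformKuramotoConnectivityCondition.sinc_mul_sq_le_mul_sin`). -/
theorem sin_chord {a b : ℝ} (ha : 0 ≤ a) (hab : a ≤ b) (hb0 : 0 < b) (hbπ : b ≤ Real.pi) :
    a / b * Real.sin b ≤ Real.sin a := by
  have hconc := strictConcaveOn_sin_Icc.concaveOn
  have h0 : (0 : ℝ) ∈ Icc 0 Real.pi := ⟨le_rfl, Real.pi_pos.le⟩
  have hbm : b ∈ Icc 0 Real.pi := ⟨hb0.le, hbπ⟩
  have hwa : 0 ≤ 1 - a / b := by rw [sub_nonneg, div_le_one hb0]; exact hab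
  have hwb : 0 ≤ a / b := div_nonneg ha hb0.le
  have h := hconc.2 h0 hbm hwa hwb (by ring)
  simp only [smul_eq_mul, mul_zero, Real.sin_zero, zero_add] at h
  rw [div_mul_cancel₀ a hb0.ne'] at h
  exact h

/-- `sinc` is antitone on `[0, π]` (absent from Mathlib's `Sinc.lean`). -/
theorem sinc_antitoneOn : AntitoneOn Real.sinc (Icc 0 Real.pi) := by
  intro a ha b hb hab
  rcases eq_or_lt_of_le ha.1 with h0 | ha0
  · rw [← h0, Real.sinc_zero]; exact Real.sinc_le_one b
  · have hb0 : 0 < b := ha0.trans_le hab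
    rw [Real.sinc_of_ne_zero ha0.ne', Real.sinc_of_ne_zero hb0.ne', div_le_div_iff₀ hb0 ha0]
    have h := sin_chord ha.1 hab hb0 hb.2
    rw [div_mul_eq_mul_div, div_le_iff₀ hb0] at h
    linarith

/-- `sinc x ≥ 0` for `|x| ≤ π`. [textbook] -/
theorem sinc_nonneg_of_abs_le_pi {x : ℝ} (hx : |x| ≤ Real.pi) : 0 ≤ Real.sinc x := by
  rw [← sinc_abs]
  rcases eq_or_lt_of_le (abs_nonneg x) with h0 | h0
  · rw [← h0, Real.sinc_zero]; exact zero_le_one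
  · rw [Real.sinc_of_ne_zero h0.ne']
    exact div_nonneg (Real.sin_nonneg_of_nonneg_of_le_pi (abs_nonneg x) hx) (abs_nonneg x)

/-- Radial non-collapse of one `sinc` factor: shrinking the argument towards `0` does not decrease `sinc`. -/
theorem sinc_le_sinc_smul {l a : ℝ} (hl0 : 0 ≤ l) (hl1 : l ≤ 1) (ha : |a| ≤ Real.pi) :
    Real.sinc a ≤ Real.sinc (l * a) := by
  rw [← sinc_abs a, ← sinc_abs (l * a), abs_mul, abs_of_nonneg hl0]
  have hla : l * |a| ≤ |a| := mul_le_of_le_one_left (abs_nonneg a) hl1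
  exact sinc_antitoneOn ⟨mul_nonneg hl0 (abs_nonneg a), hla.trans ha⟩ ⟨abs_nonneg a, ha⟩ hla

/-- `sinc² a ≤ sinc² (l·a)` for `0 ≤ l ≤ 1`, `|a| ≤ π` (radial non-collapse of one Haar factor). [textbook] -/
theorem sinc_sq_le_sinc_sq_smul {l a : ℝ} (hl0 : 0 ≤ l) (hl1 : l ≤ 1) (ha : |a| ≤ Real.pi) :
    Real.sinc a ^ 2 ≤ Real.sinc (l * a) ^ 2 :=
  pow_le_pow_left₀ (sinc_nonneg_of_abs_le_pi ha) (sinc_le_sinc_smul hl0 hl1 ha) 2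

/-- The product over roots: `∏ sinc²(αᵢ) ≤ ∏ sinc²(l·αᵢ)` for `0 ≤ l ≤ 1`, `|αᵢ| ≤ π`. -/
theorem prod_sinc_sq_le_smul {ι : Type*} (s : Finset ι) (α : ι → ℝ) {l : ℝ} (hl0 : 0 ≤ l) (hl1 : l ≤ 1)
    (hα : ∀ i ∈ s, |α i| ≤ Real.pi) :
    ∏ i ∈ s, Real.sinc (α i) ^ 2 ≤ ∏ i ∈ s, Real.sinc (l * α i) ^ 2 :=
  Finset.prod_le_prod (fun _ _ => sq_nonneg _) fun i hi => sinc_sq_le_sinc_sq_smul hl0 hl1 (hα i hi)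

/-- **THE HAAR JACOBIAN IS RADIALLY NON-COLLAPSING.**  For the exponential-chart Haar density
`J(X) = ∏_{roots} sinc²(α_r(X))` (`α_r` linear; tree: `B10Eq18SigmaSU2Haar` `expWeight = (2π²)⁻¹ sinc²‖A‖`,
`HaarDensityCompactExplicit.det_jac_eq_prod_sinc_roots`), `J(X) ≤ J(l • X)` for `0 ≤ l ≤ 1` on `|α_r(X)| ≤ π`. -/
theorem haarJacobian_radial {E ι : Type*} [AddCommGroup E] [Module ℝ E] (s : Finset ι) (α : ι → E →ₗ[ℝ] ℝ)
    {l : ℝ} (hl0 : 0 ≤ l) (hl1 : l ≤ 1) {x : E} (hx : ∀ i ∈ s, |α i x| ≤ Real.pi) :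
    ∏ i ∈ s, Real.sinc (α i x) ^ 2 ≤ ∏ i ∈ s, Real.sinc (α i (l • x)) ^ 2 := by
  simp only [map_smul, smul_eq_mul]
  exact prod_sinc_sq_le_smul s (fun i => α i x) hl0 hl1 hx

/-- Knit to the partial-dilation hypothesis `g x ≤ g (D_λ x)` (n21-d G18): a product density whose block factors
are radially non-collapsing and whose off-block factors are untouched is non-collapsing under `D_λ`. -/
theorem prod_le_prod_partialDilation {ι E : Type*} [Fintype ι] [DecidableEq ι] [SMul ℝ E] (b : Finset ι)
    (J : ι → E → ℝ) (hJ : ∀ i y, 0 ≤ J i y) {l : ℝ} (x : ι → E)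
    (hrad : ∀ i ∈ b, J i (x i) ≤ J i (l • x i)) :
    ∏ i, J i (x i) ≤ ∏ i, J i (if i ∈ b then l • x i else x i) := by
  refine Finset.prod_le_prod (fun i _ => hJ i _) fun i _ => ?_
  split_ifs with hi
  · exact hrad i hi
  · exact le_rfl

/-- The same knit in the MULTIPLICATIVE shape of n21-d's G18 as landed (`…N21PartialDilationHazard`, 19:33Z):
`D_λ x = fun i => (if i ∈ b then l else 1) • x i` (for `E = ℝ` this is G18's `(if i ∈ b then l else 1) * x i`). -/
theorem prod_le_prod_partialDilation_mulShape {ι E : Type*} [Fintype ι] [DecidableEq ι] [MulAction ℝ E]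
    (b : Finset ι) (J : ι → E → ℝ) (hJ : ∀ i y, 0 ≤ J i y) {l : ℝ} (x : ι → E)
    (hrad : ∀ i ∈ b, J i (x i) ≤ J i (l • x i)) :
    ∏ i, J i (x i) ≤ ∏ i, J i ((if i ∈ b then l else 1) • x i) := by
  refine Finset.prod_le_prod (fun i _ => hJ i _) fun i _ => ?_
  split_ifs with hi
  · exact hrad i hi
  · rw [one_smul]

/-- … and a product of two non-collapsing nonnegative factors (Boltzmann factor × Haar Jacobian) is non-collapsing. -/
theorem mul_radial_of_radial {X : Type*} (f J : X → ℝ) (T : X → X) (hf0 : ∀ x, 0 ≤ f x) (hJ0 : ∀ x, 0 ≤ J x)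
    {x : X} (hf : f x ≤ f (T x)) (hJ : J x ≤ J (T x)) : f x * J x ≤ f (T x) * J (T x) :=
  mul_le_mul hf hJ (hJ0 x) (hf0 (T x))

end Summit.QuantumFields.YangMills.Theorems.N21HaarRadialJacobian
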